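import Summits.Ventures.HodgeRepro2.T5SU11ResolventNeumann
import Summits.Ventures.HodgeRepro2.T5SU11KernelDifferenceRegularity

/-!
# The composed kernels are the iterated Green's functions: `(L − μ) K_λ^{∘(n+2)}(·, s) = K_λ^{∘(n+1)}(·, s)` on `(0, ∞)`,
and `(L − μ) K_λ(·, s) = 0` off the diagonal

The kernel `K_λ(·, s) = −χ_λ(s) φ_λ` on `(0, s]` and `−φ_λ(s) χ_λ` on `[s, ∞)` solves the homogeneous radial equation
`sinh 2t u″ + 2 cosh 2t u′ = μ sinh 2t u` on each side of the diagonal (rows 4xx). The composed kernel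
`K_λ^{∘(n+2)}(·, s) = G^I_λ K_λ^{∘(n+1)}(·, s)` is the improper Green's solution of a class source (row 503), hence `C²` on
`(0, ∞)` with the inhomogeneous equation of row 49x:

* `kernel_ode_of_lt`, `kernel_ode_of_gt` — **`(L − μ) K_λ(·, s) = 0` on `(0, s)` and on `(s, ∞)`** (with the explicit
  derivatives `−χ_λ(s) φ_λ′`, `−χ_λ(s) φ_λ″` and `−φ_λ(s) χ_λ′`, `−φ_λ(s) χ_λ″`);
* `hasDerivAt_kernel_comp_succ`, `hasDerivAt_kernel_comp_succ'` — the first and second derivatives of `K_λ^{∘(n+2)}(·, s)`;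
* `kernel_comp_ode` — **`sinh 2t ∂²_t K^{∘(n+2)} + 2 cosh 2t ∂_t K^{∘(n+2)} = μ sinh 2t K^{∘(n+2)} + sinh 2t K^{∘(n+1)}`**:
  the composed kernels are the iterated Green's functions of the radial operator.

Nothing is claimed about (N).

Blind lane: Mathlib + the HodgeRepro2 prefix only; no sorry; axioms ⊆ {propext, Classical.choice,
Quot.sound}.
-/

namespace Summit.Ventures.HodgeRepro2.T5SU11KernelCompositionODE

open Filter Topology MeasureTheory
open Set (Ioi Ioc Ioo)
open T5SU11Cartan T5SU11SphericalFunction T5SU11SphericalBounds T5SU11SphericalDecay T5SU11SphericalSolutionSpaceAll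
  T5SU11RadialGreenKernel T5SU11RadialGreenImproper T5SU11RadialGreenImproperDecaySource T5SU11ResolventNeumann
  T5SU11KernelDifferenceRegularity

section measure

variable [MeasurableSpace Circle] [BorelSpace Circle]

variable {lam : ℝ} (hlam : 1 < lam) {s : ℝ} (hs : 0 < s)

/-! ### The kernel off the diagonal -/

/-- **`(L − μ) K_λ(·, s) = 0` on `(0, s)`**: there `K_λ(t, s) = −χ_λ(s) φ_λ(a_t)`, with the derivatives `−χ_λ(s) φ_λ′` and
`−χ_λ(s) φ_λ″`. -/
theorem kernel_ode_of_lt {t : ℝ} (ht : 0 < t) (hts : t < s) :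
    (∀ᶠ r in 𝓝 t, sphGreenKernel lam r s = -(sphDecay lam s * sph lam (hyp r))) ∧
    HasDerivAt (fun r => sphGreenKernel lam r s) (-(sphDecay lam s * deriv (fun t => sph lam (hyp t)) t)) t ∧
    Real.sinh (2 * t) * (-(sphDecay lam s * deriv (deriv fun t => sph lam (hyp t)) t))
        + 2 * Real.cosh (2 * t) * (-(sphDecay lam s * deriv (fun t => sph lam (hyp t)) t))
      = lam * (lam - 2) * Real.sinh (2 * t) * sphGreenKernel lam t s := by
  have hev : ∀ᶠ r in 𝓝 t, sphGreenKernel lam r s = -(sphDecay lam s * sph lam (hyp r)) := by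
    filter_upwards [Iio_mem_nhds hts] with r hr
    unfold sphGreenKernel
    rw [greenKernel_of_ge _ _ (le_of_lt hr)]
    ring
  refine ⟨hev, ?_, ?_⟩
  · have h := ((hφ_sph lam) t ht).const_mul (sphDecay lam s) |>.neg
    refine h.congr_of_eventuallyEq ?_
    filter_upwards [hev] with r hr
    rw [hr]
    rfl
  · have e := hode_sph lam t ht
    rw [hev.self_of_nhds]
    linear_combination -(sphDecay lam s) * e

include hlam hs in
/-- **`(L − μ) K_λ(·, s) = 0` on `(s, ∞)`**: there `K_λ(t, s) = −φ_λ(a_s) χ_λ(t)`, with the derivatives `−φ_λ(a_s) χ_λ′` and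
`−φ_λ(a_s) χ_λ″`. -/
theorem kernel_ode_of_gt {t : ℝ} (hst : s < t) :
    (∀ᶠ r in 𝓝 t, sphGreenKernel lam r s = -(sph lam (hyp s) * sphDecay lam r)) ∧
    HasDerivAt (fun r => sphGreenKernel lam r s) (-(sph lam (hyp s) * sphDecay' lam t)) t ∧
    Real.sinh (2 * t) * (-(sph lam (hyp s) * sphDecay'' lam t))
        + 2 * Real.cosh (2 * t) * (-(sph lam (hyp s) * sphDecay' lam t))
      = lam * (lam - 2) * Real.sinh (2 * t) * sphGreenKernel lam t s := by
  have ht : 0 < t := lt_trans hs hst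
  have hev : ∀ᶠ r in 𝓝 t, sphGreenKernel lam r s = -(sph lam (hyp s) * sphDecay lam r) := by
    filter_upwards [Ioi_mem_nhds hst] with r hr
    unfold sphGreenKernel
    rw [greenKernel_of_le _ _ (le_of_lt hr)]
  refine ⟨hev, ?_, ?_⟩
  · have h := (hasDerivAt_sphDecay hlam ht).const_mul (sph lam (hyp s)) |>.neg
    refine h.congr_of_eventuallyEq ?_
    filter_upwards [hev] with r hr
    rw [hr]
    rfl
  · have e := sphDecay_ode hlam ht
    rw [hev.self_of_nhds]
    linear_combination -(sph lam (hyp s)) * e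

/-! ### The composed kernels -/

include hlam hs in
/-- The class data of the composed kernel `K_λ^{∘(n+1)}(·, s)` needed by the improper Green's formula: continuity on `(0, ∞)`
and integrability against the basis. -/
theorem kernel_comp_basis_integrable (n : ℕ) :
    ContinuousOn ((greenSolI (fun t => sph lam (hyp t)) (sphDecay lam))^[n] (fun r => sphGreenKernel lam r s)) (Ioi 0) ∧
    (∀ T, IntegrableOn (fun r => sph lam (hyp r)
      * ((greenSolI (fun t => sph lam (hyp t)) (sphDecay lam))^[n] (fun r => sphGreenKernel lam r s)) r
      * Real.sinh (2 * r)) (Ioc 0 T)) ∧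
    IntegrableOn (fun r => sphDecay lam r
      * ((greenSolI (fun t => sph lam (hyp t)) (sphDecay lam))^[n] (fun r => sphGreenKernel lam r s)) r
      * Real.sinh (2 * r)) (Ioi 0) := by
  obtain ⟨Ms, hMs0, hMs⟩ := kernel_source_bounded hlam hs
  obtain ⟨Cs, s₀, hCs⟩ := kernel_source_decay hlam hs
  have hks := kernel_source_continuousOn hlam hs
  have hεk : 2 - lam < lam := by linarith
  obtain ⟨hcn, ⟨Mn, hMn0, hMn⟩, hdn⟩ := iterate_class (lam₂ := lam) hlam hks hMs hMs0 hεk hCs n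
  obtain ⟨Kn, Tn, _, _, hKn⟩ := hdn ((1 + lam) / 2) (by rw [min_self]; linarith)
  have hε : 2 - lam < (1 + lam) / 2 := by linarith
  exact ⟨hcn, integrableOn_sph_mul_mul_sinh_Ioc hcn hMn hMn0 lam,
    integrableOn_sphDecay_mul_mul_sinh hlam hcn hMn hMn0 hε hKn⟩

include hlam hs in
/-- **The derivative of the composed kernel `K_λ^{∘(n+2)}(·, s) = G^I_λ K_λ^{∘(n+1)}(·, s)`** on `(0, ∞)`. -/
theorem hasDerivAt_kernel_comp_succ (n : ℕ) {t : ℝ} (ht : 0 < t) :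
    HasDerivAt ((greenSolI (fun t => sph lam (hyp t)) (sphDecay lam))^[n + 1] (fun r => sphGreenKernel lam r s))
      (greenSolI' (deriv fun t => sph lam (hyp t)) (sphDecay' lam) (fun t => sph lam (hyp t)) (sphDecay lam)
        ((greenSolI (fun t => sph lam (hyp t)) (sphDecay lam))^[n] (fun r => sphGreenKernel lam r s)) t) t := by
  obtain ⟨hc, hB, hA⟩ := kernel_comp_basis_integrable hlam hs n
  rw [Function.iterate_succ_apply']
  exact hasDerivAt_greenSolI (hφ_sph lam) (fun _ hr => hasDerivAt_sphDecay hlam hr) hc hB hA ht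

include hlam hs in
/-- **The second derivative of the composed kernel `K_λ^{∘(n+2)}(·, s)`** on `(0, ∞)`. -/
theorem hasDerivAt_kernel_comp_succ' (n : ℕ) {t : ℝ} (ht : 0 < t) :
    HasDerivAt (greenSolI' (deriv fun t => sph lam (hyp t)) (sphDecay' lam) (fun t => sph lam (hyp t)) (sphDecay lam)
        ((greenSolI (fun t => sph lam (hyp t)) (sphDecay lam))^[n] (fun r => sphGreenKernel lam r s)))
      (greenSolI'' (deriv (deriv fun t => sph lam (hyp t))) (sphDecay'' lam) (deriv fun t => sph lam (hyp t))
        (sphDecay' lam) (fun t => sph lam (hyp t)) (sphDecay lam)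
        ((greenSolI (fun t => sph lam (hyp t)) (sphDecay lam))^[n] (fun r => sphGreenKernel lam r s)) t) t := by
  obtain ⟨hc, hB, hA⟩ := kernel_comp_basis_integrable hlam hs n
  exact hasDerivAt_greenSolI' (hφ_sph lam) (hφ'_sph lam) (fun _ hr => hasDerivAt_sphDecay hlam hr)
    (fun _ hr => hasDerivAt_sphDecay' lam hr) hc hB hA ht

include hlam in
/-- **THE COMPOSED KERNELS ARE THE ITERATED GREEN'S FUNCTIONS**: `(L − μ) K_λ^{∘(n+2)}(·, s) = K_λ^{∘(n+1)}(·, s)` on `(0, ∞)`, i.e.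
`sinh 2t · ∂²_t K^{∘(n+2)}(t, s) + 2 cosh 2t · ∂_t K^{∘(n+2)}(t, s) = μ sinh 2t · K^{∘(n+2)}(t, s) + sinh 2t · K^{∘(n+1)}(t, s)`
with the derivatives of `hasDerivAt_kernel_comp_succ` / `hasDerivAt_kernel_comp_succ'`. -/
theorem kernel_comp_ode (n : ℕ) {t : ℝ} (ht : 0 < t) :
    Real.sinh (2 * t) * greenSolI'' (deriv (deriv fun t => sph lam (hyp t))) (sphDecay'' lam)
          (deriv fun t => sph lam (hyp t)) (sphDecay' lam) (fun t => sph lam (hyp t)) (sphDecay lam)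
          ((greenSolI (fun t => sph lam (hyp t)) (sphDecay lam))^[n] (fun r => sphGreenKernel lam r s)) t
        + 2 * Real.cosh (2 * t) * greenSolI' (deriv fun t => sph lam (hyp t)) (sphDecay' lam)
          (fun t => sph lam (hyp t)) (sphDecay lam)
          ((greenSolI (fun t => sph lam (hyp t)) (sphDecay lam))^[n] (fun r => sphGreenKernel lam r s)) t
      = lam * (lam - 2) * Real.sinh (2 * t)
          * ((greenSolI (fun t => sph lam (hyp t)) (sphDecay lam))^[n + 1] (fun r => sphGreenKernel lam r s)) t
        + Real.sinh (2 * t)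
          * ((greenSolI (fun t => sph lam (hyp t)) (sphDecay lam))^[n] (fun r => sphGreenKernel lam r s)) t := by
  rw [Function.iterate_succ_apply']
  exact greenSolI_ode (hode_sph lam) (fun _ hr => sphDecay_ode hlam hr) (fun _ hr => wronskian_sphDecay hlam hr) ht

end measure

end Summit.Ventures.HodgeRepro2.T5SU11KernelCompositionODE
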